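import Literature.Probability.RandomPlanarGeometry.SAWEdgeListSurgery
import HarnessLib

/-!
# Doors: cutting and gluing self-avoiding walks between mid-edges of the hexagonal lattice

Topic `Literature/Probability/RandomPlanarGeometry`; walks between mid-edges of `ℍ` as vertex
lists, `HexMidEdgeSAW Λ a z` (`HexParafermion.lean`, after H. Duminil-Copin, S. Smirnov, *The
connective constant of the honeycomb lattice equals `√(2+√2)`*, Ann. of Math. 175 (2012),
§1–§2). A DOOR of the domain with vertex set `Λ` is a mid-edge `{u, c}` with `u ∉ Λ` (so a walk
from / to it starts / ends at `c`, `HexMidEdgeSAW.head_eq` of `HexParafermionProofs.lean`).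
For a walk `γ` between two doors `{u, c}`, `{u', c'}` whose vertex list is split into three
blocks `β ++ α ++ β'` (in the application: before the first visit to a disc, from the first to
the last visit, after the last visit) we record the elementary surgery — the "first entrance /
last exit" cutting and gluing of self-avoiding walks (N. Madras, G. Slade, *The Self-Avoiding
Walk* (1993), §3–§4), here for DCS's walks between mid-edges:

* `HexMidEdgeSAW.edges_ext_nodup` — the used (half-)edges `a, {v₁,v₂}, …, z` are the
  consecutive pairs of the extended list `u, v₁, …, vₙ, u'`, hence pairwise distinct;
* `HexMidEdgeSAW.mem_sdiff_of_mem_mid`, `notMem_sdiff_of_cons_eq_concat`,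
  `notMem_sdiff_of_concat_eq_cons` — the middle block lies in the REDUCED DOMAIN `Λ ∖ β ∖ β'`,
  the vertices `p` (before `α`, or `u`) and `p'` (after `α`, or `u'`) do not;
* `HexMidEdgeSAW.rel_door_head`, `HexMidEdgeSAW.rel_getLast_door` — `p ∼ head α`,
  `last α ∼ p'`; `HexMidEdgeSAW.door_ne_door` — the two new doors `{p, head α}`,
  `{p', last α}` are distinct; `HexMidEdgeSAW.head?_getLast?_of_doors`;
* **`HexMidEdgeSAW.exists_cut`** — the middle block is a walk of the reduced domain between the
  two new doors (with steps in any graph `H` containing the steps of `γ`);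
* **`HexMidEdgeSAW.exists_glue`** — conversely every such walk of the reduced domain, glued to
  `β` and `β'`, is a walk of `Λ` between the original doors.

Together these make `γ ↦ α` a bijection between the walks of `Λ` with prescribed outer blocks
`β, β'` and prescribed end entries of the middle block, and the walks of the reduced domain
between the new doors (used for the reversal recursion of the `HexTight` crux of
`Summits/CriticalPhenomena/SAWScalingLimit`). Everything is [folklore]; no statement of the
sources is vendored here.
-/

namespace Literature.Probability.RandomPlanarGeometry.SAW

open Literature.Probability.LatticeModels

section Doors

variable {Λ : Finset HexVertex} {a z : Sym2 HexVertex}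

/-- The outer vertex `p` of the entrance door of a middle block (`u :: β = I ++ [p]`, `u ∉ Λ`)
is not in the reduced domain `Λ ∖ β ∖ β'`. [folklore] -/
theorem notMem_sdiff_of_cons_eq_concat {u p : HexVertex} {β I : List HexVertex}
    (β' : List HexVertex) (hu : u ∉ Λ) (hp : u :: β = I ++ [p]) :
    p ∉ (Λ \ β.toFinset) \ β'.toFinset := by
  have hmem : p ∈ u :: β := by rw [hp]; simp
  intro h
  simp only [Finset.mem_sdiff, List.mem_toFinset] at h
  rcases List.mem_cons.1 hmem with h' | h'
  · exact hu (h' ▸ h.1.1)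
  · exact h.1.2 h'

/-- The outer vertex `p'` of the exit door of a middle block (`β' ++ [u'] = p' :: T`, `u' ∉ Λ`)
is not in the reduced domain `Λ ∖ β ∖ β'`. [folklore] -/
theorem notMem_sdiff_of_concat_eq_cons {u' p' : HexVertex} {β' T : List HexVertex}
    (β : List HexVertex) (hu' : u' ∉ Λ) (hp' : β' ++ [u'] = p' :: T) :
    p' ∉ (Λ \ β.toFinset) \ β'.toFinset := by
  have hmem : p' ∈ β' ++ [u'] := by rw [hp']; simp
  intro h
  simp only [Finset.mem_sdiff, List.mem_toFinset] at h
  rcases List.mem_append.1 hmem with h' | h'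
  · exact h.2 h'
  · exact hu' ((List.mem_singleton.1 h') ▸ h.1.1)

namespace HexMidEdgeSAW

/-- A walk to the door `z = {u', c'}` with `u' ∉ Λ` ends at `c'`. [folklore] -/
theorem getLast_eq_of_door (γ : HexMidEdgeSAW Λ a z) {u' c' : HexVertex} (hz : z = s(u', c'))
    (hu' : u' ∉ Λ) (hne : γ.verts ≠ []) : γ.verts.getLast hne = c' := by
  subst hz
  rcases γ.getLast_eq_or hne with h | h
  · exact absurd (h ▸ γ.subset _ (List.getLast_mem hne)) hu'
  · exact h

/-- A walk from the door `a = {u, c}` with `u ∉ Λ` starts at `c` (`head?` form). [folklore] -/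
theorem head?_eq_of_door (γ : HexMidEdgeSAW Λ a z) {u c : HexVertex} (ha : a = s(u, c))
    (hu : u ∉ Λ) (hne : γ.verts ≠ []) : γ.verts.head? = some c := by
  rw [List.head?_eq_some_head hne, γ.head_eq ha hu hne]

/-- A walk to the door `z = {u', c'}` with `u' ∉ Λ` ends at `c'` (`getLast?` form). [folklore] -/
theorem getLast?_eq_of_door (γ : HexMidEdgeSAW Λ a z) {u' c' : HexVertex} (hz : z = s(u', c'))
    (hu' : u' ∉ Λ) (hne : γ.verts ≠ []) : γ.verts.getLast? = some c' := by
  rw [List.getLast?_eq_some_getLast hne, γ.getLast_eq_of_door hz hu' hne]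

/-- **Edges between doors.** For a walk from the door `{u, c}` to the door `{u', c'}`
(`u, u' ∉ Λ`) the list of used (half-)edges `a, {v₁,v₂}, …, {vₙ₋₁,vₙ}, z` is the list of
consecutive pairs of the extended vertex list `u, v₁, …, vₙ, u'`; in particular the latter is
duplicate-free. [folklore] -/
theorem edges_ext_nodup (γ : HexMidEdgeSAW Λ a z) {u c u' c' : HexVertex} (ha : a = s(u, c))
    (hz : z = s(u', c')) (hu : u ∉ Λ) (hu' : u' ∉ Λ) (hne : γ.verts ≠ []) :
    (List.zipWith (fun v w => s(v, w)) (u :: γ.verts ++ [u'])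
      (u :: γ.verts ++ [u']).tail).Nodup := by
  rw [edges_cons_concat (γ.head?_eq_of_door ha hu hne) (γ.getLast?_eq_of_door hz hu' hne),
    Sym2.eq_swap (a := c') (b := u'), ← ha, ← hz]
  exact γ.edges_nodup hne

/-- The entries of the middle block of a walk split as `β ++ α ++ β'` lie in the reduced domain
`Λ ∖ β ∖ β'`. [folklore] -/
theorem mem_sdiff_of_mem_mid (γ : HexMidEdgeSAW Λ a z) {β α β' : List HexVertex}
    (hdec : γ.verts = β ++ α ++ β') {v : HexVertex} (hv : v ∈ α) :
    v ∈ (Λ \ β.toFinset) \ β'.toFinset := by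
  have hnd := γ.nodup
  rw [hdec, List.nodup_append, List.nodup_append] at hnd
  obtain ⟨⟨-, -, hβα⟩, -, hαβ'⟩ := hnd
  simp only [Finset.mem_sdiff, List.mem_toFinset]
  exact ⟨⟨γ.subset v (by rw [hdec]; simp [hv]), fun h => hβα v h v hv rfl⟩,
    fun h => hαβ' v (List.mem_append_right β hv) v h rfl⟩

/-- The vertex before the middle block (`u` if the prefix is empty) is related to its first entry
by any relation chaining the walk and the entrance door. [folklore] -/
theorem rel_door_head {R : HexVertex → HexVertex → Prop} (γ : HexMidEdgeSAW Λ a z)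
    (hR : γ.verts.IsChain R) {u c : HexVertex} (ha : a = s(u, c)) (hu : u ∉ Λ) (huc : R u c)
    {β α β' I : List HexVertex} {p c₁ : HexVertex} (hdec : γ.verts = β ++ α ++ β')
    (hh : α.head? = some c₁) (hp : u :: β = I ++ [p]) : R p c₁ := by
  have hα : α ≠ [] := by rintro rfl; simp at hh
  have hne : γ.verts ≠ [] := by rw [hdec]; simp [hα]
  have hch : List.IsChain R (u :: γ.verts) :=
    List.IsChain.cons_of_ne_nil hne hR (by rw [γ.head_eq ha hu hne]; exact huc)
  have e : u :: γ.verts = (I ++ [p]) ++ (α ++ β') := by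
    rw [hdec, ← hp]; simp only [List.cons_append, List.append_assoc]
  rw [e, List.isChain_append] at hch
  refine hch.2.2 p ?_ c₁ ?_
  · rw [Option.mem_def, List.getLast?_concat]
  · rw [Option.mem_def, List.head?_append, hh, Option.some_or]

/-- The last entry of the middle block is related to the vertex after it (`u'` if the suffix is
empty) by any relation chaining the walk and the exit door. [folklore] -/
theorem rel_getLast_door {R : HexVertex → HexVertex → Prop} (γ : HexMidEdgeSAW Λ a z)
    (hR : γ.verts.IsChain R) {u' c' : HexVertex} (hz : z = s(u', c')) (hu' : u' ∉ Λ)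
    (huc' : R c' u') {β α β' T : List HexVertex} {p' c₂ : HexVertex}
    (hdec : γ.verts = β ++ α ++ β') (hl : α.getLast? = some c₂) (hp' : β' ++ [u'] = p' :: T) :
    R c₂ p' := by
  have hα : α ≠ [] := by rintro rfl; simp at hl
  have hne : γ.verts ≠ [] := by rw [hdec]; simp [hα]
  have hch : List.IsChain R (γ.verts ++ [u']) := by
    refine List.IsChain.append hR (List.isChain_singleton u') fun x hx y hy => ?_
    rw [Option.mem_def, γ.getLast?_eq_of_door hz hu' hne, Option.some.injEq] at hx
    rw [Option.mem_def, List.head?_cons, Option.some.injEq] at hy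
    rw [← hx, ← hy]; exact huc'
  have e : γ.verts ++ [u'] = (β ++ α) ++ (p' :: T) := by rw [hdec, ← hp', List.append_assoc]
  rw [e, List.isChain_append] at hch
  refine hch.2.2 c₂ ?_ p' rfl
  rw [Option.mem_def, List.getLast?_append, hl, Option.some_or]

/-- **The two doors of a middle block differ**: `{p, c₁} ≠ {p', c_L}` where `c₁`, `c_L` are the
first and last entries of the block and `p`, `p'` the vertices before and after it. [folklore] -/
theorem door_ne_door (γ : HexMidEdgeSAW Λ a z) {u c u' c' : HexVertex} (ha : a = s(u, c))
    (hz : z = s(u', c')) (hu : u ∉ Λ) (hu' : u' ∉ Λ)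
    {β α β' I T : List HexVertex} {p p' c₁ c₂ : HexVertex}
    (hdec : γ.verts = β ++ α ++ β') (hh : α.head? = some c₁) (hl : α.getLast? = some c₂)
    (hp : u :: β = I ++ [p]) (hp' : β' ++ [u'] = p' :: T) : s(p, c₁) ≠ s(p', c₂) := by
  have hα : α ≠ [] := by rintro rfl; simp at hh
  have hne : γ.verts ≠ [] := by rw [hdec]; simp [hα]
  have hext : u :: γ.verts ++ [u'] = I ++ [p] ++ α ++ p' :: T := by
    rw [hdec, ← hp, ← hp']; simp only [List.cons_append, List.append_assoc]
  intro hmm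
  rcases Sym2.eq_iff.1 hmm with ⟨hpp', h12⟩ | ⟨hp2, -⟩
  · have hN := γ.edges_ext_nodup ha hz hu hu' hne
    rw [hext, edges_splice, edges_cons_concat hh hl] at hN
    have hmid := hN.sublist ((List.infix_append _ _ _).sublist)
    rw [List.cons_append, List.nodup_cons] at hmid
    refine hmid.1 (List.mem_append_right _ (List.mem_singleton.2 ?_))
    rw [hpp', h12, Sym2.eq_swap]
  · exact notMem_sdiff_of_cons_eq_concat β' hu hp (hp2 ▸ γ.mem_sdiff_of_mem_mid hdec
      (List.mem_of_getLast? hl))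

/-- A walk of the reduced domain between the doors `{p, c₁}`, `{p', c_L}` (`p, p'` outside,
doors distinct) runs from `c₁` to `c_L`. [folklore] -/
theorem head?_getLast?_of_doors {Λ' : Finset HexVertex} {p p' c₁ c₂ : HexVertex} (hp : p ∉ Λ')
    (hp' : p' ∉ Λ') (hm : s(p, c₁) ≠ s(p', c₂)) (δ : HexMidEdgeSAW Λ' s(p, c₁) s(p', c₂)) :
    δ.verts.head? = some c₁ ∧ δ.verts.getLast? = some c₂ :=
  have hne : δ.verts ≠ [] := fun h => hm (δ.eq_of_nil h)
  ⟨δ.head?_eq_of_door rfl hp hne, δ.getLast?_eq_of_door rfl hp' hne⟩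

/-- **Cutting.** The middle block `α` of a walk `β ++ α ++ β'` between the doors `{u, c}`,
`{u', c'}` whose steps lie in `H` is a walk of the reduced domain `Λ ∖ β ∖ β'` between the doors
`{p, c₁}` and `{p', c_L}` (`p` the vertex before `α`, or `u`; `p'` the vertex after it, or `u'`),
with steps in `H`. [folklore] -/
theorem exists_cut (γ : HexMidEdgeSAW Λ a z) {H : SimpleGraph HexVertex}
    {u c u' c' : HexVertex} (ha : a = s(u, c)) (hz : z = s(u', c')) (hu : u ∉ Λ) (hu' : u' ∉ Λ)
    (hγ : γ.verts.IsChain H.Adj) {β α β' I T : List HexVertex} {p p' c₁ c₂ : HexVertex}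
    (hdec : γ.verts = β ++ α ++ β') (hh : α.head? = some c₁) (hl : α.getLast? = some c₂)
    (hp : u :: β = I ++ [p]) (hp' : β' ++ [u'] = p' :: T) (hpc : hexGraph.Adj p c₁) :
    ∃ δ : HexMidEdgeSAW ((Λ \ β.toFinset) \ β'.toFinset) s(p, c₁) s(p', c₂),
      δ.verts.IsChain H.Adj ∧ δ.verts = α := by
  have hα : α ≠ [] := by rintro rfl; simp at hh
  have hne : γ.verts ≠ [] := by rw [hdec]; simp [hα]
  have hsub : α <:+: γ.verts := by rw [hdec]; exact List.infix_append β α β'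
  have hext : u :: γ.verts ++ [u'] = I ++ [p] ++ α ++ p' :: T := by
    rw [hdec, ← hp, ← hp']; simp only [List.cons_append, List.append_assoc]
  refine ⟨⟨α, fun v hv => γ.mem_sdiff_of_mem_mid hdec hv, γ.nodup.sublist hsub.sublist,
    γ.isChain.infix hsub, ?_, ?_, fun h => absurd h hα, fun _ => ?_, ?_⟩, hγ.infix hsub, rfl⟩
  · intro v hv
    rw [hh, Option.some.injEq] at hv
    rw [← hv]; exact Sym2.mem_mk_right _ _
  · intro v hv
    rw [hl, Option.some.injEq] at hv
    rw [← hv]; exact Sym2.mem_mk_right _ _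
  · rw [Sym2.eq_swap (a := p') (b := c₂), ← edges_cons_concat hh hl p p']
    have hN := γ.edges_ext_nodup ha hz hu hu' hne
    rw [hext, edges_splice] at hN
    exact hN.sublist ((List.infix_append _ _ _).sublist)
  · exact ⟨(SimpleGraph.mem_edgeSet _).2 hpc, c₁, Sym2.mem_mk_right _ _,
      γ.mem_sdiff_of_mem_mid hdec (List.mem_of_head? hh)⟩

/-- **Gluing.** Conversely, every walk of the reduced domain between the doors `{p, c₁}`,
`{p', c_L}` with steps in `H` extends by the blocks `β`, `β'` of the model walk `γ₀` to a walk of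
`Λ` between the original doors, with steps in `H`. [folklore] -/
theorem exists_glue (γ₀ : HexMidEdgeSAW Λ a z) {H : SimpleGraph HexVertex}
    {u c u' c' : HexVertex} (ha : a = s(u, c)) (hz : z = s(u', c')) (hu : u ∉ Λ) (hu' : u' ∉ Λ)
    (h₀ : γ₀.verts.IsChain H.Adj) {β α₀ β' I T : List HexVertex} {p p' c₁ c₂ : HexVertex}
    (hdec : γ₀.verts = β ++ α₀ ++ β') (hh₀ : α₀.head? = some c₁) (hl₀ : α₀.getLast? = some c₂)
    (hp : u :: β = I ++ [p]) (hp' : β' ++ [u'] = p' :: T)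
    (δ : HexMidEdgeSAW ((Λ \ β.toFinset) \ β'.toFinset) s(p, c₁) s(p', c₂))
    (hδ : δ.verts.IsChain H.Adj) :
    ∃ γ : HexMidEdgeSAW Λ a z, γ.verts.IsChain H.Adj ∧ γ.verts = β ++ δ.verts ++ β' := by
  have hpΛ' := notMem_sdiff_of_cons_eq_concat β' hu hp
  have hp'Λ' := notMem_sdiff_of_concat_eq_cons β hu' hp'
  have hm := γ₀.door_ne_door ha hz hu hu' hdec hh₀ hl₀ hp hp'
  obtain ⟨hh, hl⟩ := head?_getLast?_of_doors hpΛ' hp'Λ' hm δ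
  have hα₀ : α₀ ≠ [] := by rintro rfl; simp at hh₀
  have hα : δ.verts ≠ [] := by intro h; rw [h] at hh; simp at hh
  have hne₀ : γ₀.verts ≠ [] := by rw [hdec]; simp [hα₀]
  have hαΛ : ∀ v ∈ δ.verts, v ∈ Λ ∧ v ∉ β ∧ v ∉ β' := fun v hv => by
    simpa only [Finset.mem_sdiff, List.mem_toFinset, and_assoc] using δ.subset v hv
  have hH : (β ++ δ.verts ++ β').head? = some c := by
    rw [head?_splice_mid hh₀ hh, ← hdec]; exact γ₀.head?_eq_of_door ha hu hne₀
  have hL : (β ++ δ.verts ++ β').getLast? = some c' := by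
    rw [getLast?_splice_mid hl₀ hl, ← hdec]; exact γ₀.getLast?_eq_of_door hz hu' hne₀
  have hext₀ : u :: γ₀.verts ++ [u'] = I ++ [p] ++ α₀ ++ p' :: T := by
    rw [hdec, ← hp, ← hp']; simp only [List.cons_append, List.append_assoc]
  have hext : u :: (β ++ δ.verts ++ β') ++ [u'] = I ++ [p] ++ δ.verts ++ p' :: T := by
    rw [← hp, ← hp']; simp only [List.cons_append, List.append_assoc]
  have hc₀ : (β ++ α₀ ++ β').IsChain hexGraph.Adj := hdec ▸ γ₀.isChain
  have hH₀ : (β ++ α₀ ++ β').IsChain H.Adj := hdec ▸ h₀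
  have hnd₀ := γ₀.nodup
  rw [hdec, List.nodup_append, List.nodup_append] at hnd₀
  obtain ⟨⟨hβn, -, -⟩, hβ'n, hββ'⟩ := hnd₀
  refine ⟨⟨β ++ δ.verts ++ β', ?_, ?_, isChain_splice hc₀ δ.isChain hh₀ hh hl₀ hl, ?_, ?_, ?_,
    fun _ => ?_, γ₀.fst_mem⟩, isChain_splice hH₀ hδ hh₀ hh hl₀ hl, rfl⟩
  · intro v hv
    rcases List.mem_append.1 hv with hv | hv
    · rcases List.mem_append.1 hv with hv | hv
      · exact γ₀.subset v (by rw [hdec]; exact List.mem_append_left _ (List.mem_append_left _ hv))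
      · exact (hαΛ v hv).1
    · exact γ₀.subset v (by rw [hdec]; exact List.mem_append_right _ hv)
  · rw [List.nodup_append, List.nodup_append]
    refine ⟨⟨hβn, δ.nodup, fun x hx y hy hxy => (hαΛ y hy).2.1 (hxy ▸ hx)⟩, hβ'n,
      fun x hx y hy hxy => ?_⟩
    rcases List.mem_append.1 hx with hx | hx
    · exact hββ' x (List.mem_append_left _ hx) y hy hxy
    · exact (hαΛ x hx).2.2 (hxy ▸ hy)
  · intro v hv
    rw [hH, Option.some.injEq] at hv
    rw [← hv, ha]; exact Sym2.mem_mk_right _ _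
  · intro v hv
    rw [hL, Option.some.injEq] at hv
    rw [← hv, hz]; exact Sym2.mem_mk_right _ _
  · intro h; simp [hα] at h
  · rw [ha, hz, Sym2.eq_swap (a := u') (b := c'), ← edges_cons_concat hH hL u u', hext,
      edges_splice]
    have hN := γ₀.edges_ext_nodup ha hz hu hu' hne₀
    rw [hext₀, edges_splice] at hN
    refine nodup_splice hN ?_ ?_ ?_
    · rw [edges_cons_concat hh hl p p', Sym2.eq_swap (a := c₂) (b := p')]
      exact δ.edges_nodup hα
    · intro e he heX
      obtain ⟨v, hv, hve⟩ := exists_mem_of_mem_edges_cons_concat hh hl p p' he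
      have hv' := forall_mem_of_mem_edges _ e heX v hve
      rw [← hp, List.mem_cons] at hv'
      rcases hv' with hvu | hvβ
      · exact hu (hvu ▸ (hαΛ v hv).1)
      · exact (hαΛ v hv).2.1 hvβ
    · intro e he heZ
      obtain ⟨v, hv, hve⟩ := exists_mem_of_mem_edges_cons_concat hh hl p p' he
      have hv' := forall_mem_of_mem_edges _ e heZ v hve
      rw [← hp', List.mem_append, List.mem_singleton] at hv'
      rcases hv' with hvβ' | hvu
      · exact (hαΛ v hv).2.2 hvβ'
      · exact hu' (hvu ▸ (hαΛ v hv).1)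

end HexMidEdgeSAW

end Doors

end Literature.Probability.RandomPlanarGeometry.SAW
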